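/-
Copyright (c) 2026. All rights reserved.
Released under Apache 2.0 license as described in the file LICENSE.
Authors: abc-iut cell, prover seat abc-iut-w5-d017 (wave 5, gen 5).
-/
import Literature.IUT.LogVolume.LogSeriesDominantTerm
import HarnessLib

/-!
# When is the `p`-adic logarithm of a unit again a unit?  The ramification criterion `p ∣ e`

Proof-only companion (theorems, no definitions) of the cell's unit-logarithm census files
`UnitLogIntoMaximalIdeal.lean` (abc-iut-w5-d172: `e(K/ℚ_p) ≤ p − 1 ⇒ log_p(𝒪_K^×) ⊆ 𝔪_K`),
`UnitLogWildPrime.lean` (abc-iut-w5-d138: `πᵖ = p`, `p` odd ⇒ `‖log_p(1+π)‖ = 1`),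
`WildCubicUnitLogUnit.lean` (`p = 3`), `UnitLogWildQuartic.lean` (`e(K/ℚ₃) = 4` ⇒ never a unit) and
`UnitLogWildDyadic.lean` (`e = 2, f = 1` over `ℚ₂`).  Those files decide, place by place, whether the
image `log_p(𝒪_K^×)` of abc-iut-S1's `unitLog` MEETS THE UNIT SPHERE — the per-place criterion behind the
cell's census of the honest depth-`≥ 2` (Ind3) log-link iterates ([IUTchIII] Rmk. 1.1.1 (i), record
only).  THIS FILE settles the question at EVERY ODD residue characteristic by a single invariant, the
absolute ramification index `e = e(K/ℚ_p)` of abc-iut-S1's `RamificationInvariants.lean`: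

* **(all primes `p`)** `p ∤ e ⇒ ‖log_p u‖ ≠ 1` for every `u : K`
  (`norm_unitLog_ne_one_of_not_dvd`; so `log_p(𝒪_K^×) ∩ 𝒪_K^× = ∅`,
  `logUnits_inter_sphere_eq_empty_of_not_dvd`);
* **(`p` odd)** `p ∣ e ⇒` the principal unit `1 − ϖ^{e/p}` (`ϖ` any norm uniformizer) has a UNIT
  logarithm (`norm_unitLog_eq_one_of_dvd`, `logUnits_inter_sphere_nonempty_of_dvd`);
* hence **for odd `p`: `log_p(𝒪_K^×)` meets the unit sphere ⟺ `p ∣ e(K/ℚ_p)`**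
  (`logUnits_inter_sphere_nonempty_iff_dvd`), and for `p = 2`: `e` odd ⇒ it does not.

PROOF (classical; Neukirch, *Algebraic Number Theory* II (5.5)), with the dominant-term toolkit of
`LogSeriesDominantTerm.lean`: for a principal unit `y` with `‖1 − y‖ = ‖ϖ‖^s` the term of index `n` of
`L(y)` has norm `‖ϖ‖^{N(n)}`, `N(n) = s·n − e·v_p(n)`, minimised only at prime powers `n = p^a`, where
`h(a) = s·p^a − e·a` has a turning point `a₀`.  If `p ∤ e`: either `h(a₀) ≥ 1` (all terms in `𝔪`,
`‖L(y)‖ < 1`), or `h(a₀) ≤ 0`, which forces `a₀ ≥ 1`, hence NO TIE `e ≠ s·p^{a₀}·(p−1)` (as `p ∣ p^{a₀}`)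
and `h(a₀) ≠ 0` (else `p^{a₀} ∣ a₀·e` with `gcd(p^{a₀}, e) = 1`, i.e. `p^{a₀} ∣ a₀ < p^{a₀}`), so the term
of index `p^{a₀}` dominates strictly and `‖L(y)‖ = ‖ϖ‖^{h(a₀)} > 1`; in neither case is `L(y)` a unit,
and `log_p u = m⁻¹·L(u^m)` with `p ∤ m` reduces units to principal units.  Conversely if `p` is odd and
`e = p·k`, then for `s = k` one has `a₀ = 1`, `h(1) = 0` and `e = pk < k·p·(p−1)`: the term of index `p`
dominates strictly and `‖L(1 − ϖ^k)‖ = 1`.  (At `p = 2`, `e = 2k`, the indices `2` and `4` tie —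
`UnitLogWildDyadic.lean`; not treated here.)

Consumers: the cell's (Ind3) honest-model census (`Cor312Ind3IteratesVacuity*.lean`,
`LogLinkIteratesWildPrime.lean`), whose per-place criterion «depth-`≥ 2` image inhabited ⟺ some
`log_v(u)` is a unit» becomes, at odd `p_v`, «⟺ `p_v ∣ e(v|p_v)`».  Nothing here is disputed mathematics;
no IUT statement is asserted; nothing bears on [IUTchIII] Cor. 3.12.
-/

noncomputable section

open Metric Set

namespace Literature.IUT.LogVolume

namespace RamificationCriterion

open Literature.NumberTheory.GaloisRepresentations.Ultrametric

/-! ### §4. `p ∤ e`: the logarithm of a unit is never a unit -/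

section NotDvd

variable (p : ℕ) [hp : Fact p.Prime]
variable {K : Type*} [NontriviallyNormedField K] [instK : NormedAlgebra ℚ_[p] K] [IsUltrametricDist K]
  [ProperSpace K]

/-- **`p ∤ e(K/ℚ_p)` ⇒ `‖L(y)‖ ≠ 1` for every principal unit `y`** (all primes `p`).
[cite: NeukirchANT1999, Ch. II (5.5)] -/
theorem norm_logSeries_ne_one_of_not_dvd (he : ¬ p ∣ absRamificationIdx p K) {y : K}
    (hyP : IsPrincipal y) : ‖logSeries y‖ ≠ 1 := by
  classical
  obtain ⟨ϖ, hϖ⟩ := exists_isUniformizer (F := K)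
  have hρ0 : 0 < ‖(ϖ : K)‖ := norm_units_pos ϖ
  have he1 : 1 ≤ absRamificationIdx p K := absRamificationIdx_pos p K
  by_cases hx : 1 - y = 0
  · have : y = 1 := (sub_eq_zero.mp hx).symm
    rw [this, logSeries_one, norm_zero]
    exact zero_ne_one
  -- `‖1 - y‖ = ‖ϖ‖^s` with `s ≥ 1`
  obtain ⟨s, hs⟩ := hϖ.2 (Units.mk0 (1 - y) hx)
  rw [Units.val_mk0] at hs
  have hs1 : 1 ≤ s := by
    have h1 : ‖(ϖ : K)‖ ^ s < 1 := hs ▸ hyP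
    have := (zpow_lt_one_iff_right_of_lt_one₀ hρ0 hϖ.1).mp h1
    omega
  -- abbreviations (as plain hypotheses, to keep the arithmetic linear in the atoms)
  set e : ℕ := absRamificationIdx p K with he_def
  have hP : (2 : ℤ) ≤ (p : ℤ) := by exact_mod_cast hp.out.two_le
  have hE : (1 : ℤ) ≤ (e : ℤ) := by exact_mod_cast he1
  -- the turning point `a₀`
  have hex : ∃ a : ℕ, (e : ℤ) ≤ s * (p : ℤ) ^ a * ((p : ℤ) - 1) := exists_le_increment hs1 hP e
  obtain ⟨a₀, hhi, hlo'⟩ : ∃ a₀ : ℕ, (e : ℤ) ≤ s * (p : ℤ) ^ a₀ * ((p : ℤ) - 1) ∧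
      ∀ a < a₀, ¬ (e : ℤ) ≤ s * (p : ℤ) ^ a * ((p : ℤ) - 1) :=
    ⟨Nat.find hex, Nat.find_spec hex, fun a ha ↦ Nat.find_min hex ha⟩
  have hlo : ∀ a < a₀, s * (p : ℤ) ^ a * ((p : ℤ) - 1) < e := fun a ha ↦ lt_of_not_ge (hlo' a ha)
  have hmin := exponent_min (a₀ := a₀) hs1 hP hlo hhi
  -- every index is bounded below by `h(a₀)`
  have hall : ∀ n : ℕ, s * (p : ℤ) ^ a₀ - e * (a₀ : ℤ)
      ≤ s * ((n + 1 : ℕ) : ℤ) - (e : ℤ) * (padicValNat p (n + 1) : ℤ) := by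
    intro n
    obtain ⟨a, ha, -⟩ := exists_exponent_le_index (p := p) hs1 e (Nat.succ_ne_zero n)
    exact (hmin a).trans ha
  rcases le_or_gt 1 (s * (p : ℤ) ^ a₀ - e * (a₀ : ℤ)) with hpos | hnonpos
  · -- every term lies in `𝔪`: `‖L(y)‖ ≤ ‖ϖ‖ < 1`
    have hle := norm_logSeries_le_norm_unif p hϖ hs fun n ↦ hpos.trans (hall n)
    exact ne_of_lt (hle.trans_lt hϖ.1)
  · -- `h(a₀) ≤ 0`: then `a₀ ≥ 1`, no tie (`p ∤ e`), `h(a₀) ≠ 0`, and the term `p^{a₀}` dominates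
    have hnonpos : s * (p : ℤ) ^ a₀ - e * (a₀ : ℤ) ≤ 0 := by omega
    have ha₀ : a₀ ≠ 0 := by
      rintro rfl
      rw [pow_zero, Nat.cast_zero, mul_zero, sub_zero, mul_one] at hnonpos
      omega
    -- no tie: `e ≠ s p^{a₀} (p-1)` since `p ∣ p^{a₀}` but `p ∤ e`
    have hhi' : (e : ℤ) < s * (p : ℤ) ^ a₀ * ((p : ℤ) - 1) := by
      refine lt_of_le_of_ne hhi fun heq ↦ he ?_
      have hdvd : (p : ℤ) ∣ (e : ℤ) := by
        rw [heq]
        exact ((dvd_pow_self (p : ℤ) ha₀).mul_left s).mul_right _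
      exact Int.natCast_dvd_natCast.mp hdvd
    have hstrict : ∀ a : ℕ, a ≠ a₀ →
        s * (p : ℤ) ^ a₀ - e * (a₀ : ℤ) + 1 ≤ s * (p : ℤ) ^ a - e * (a : ℤ) :=
      fun a ha ↦ exponent_min_strict (a₀ := a₀) hs1 hP hlo hhi' ha
    -- `h(a₀) ≠ 0`: else `p^{a₀} ∣ a₀ · e` with `gcd(p^{a₀}, e) = 1`, so `p^{a₀} ∣ a₀ < p^{a₀}`
    have hne0 : s * (p : ℤ) ^ a₀ - e * (a₀ : ℤ) ≠ 0 := by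
      intro h0
      have heq' : s.toNat * p ^ a₀ = e * a₀ := by
        have h2 : ((s.toNat * p ^ a₀ : ℕ) : ℤ) = ((e * a₀ : ℕ) : ℤ) := by
          push_cast
          rw [Int.toNat_of_nonneg (by omega)]
          linarith
        exact_mod_cast h2
      have hcop : Nat.Coprime (p ^ a₀) e :=
        Nat.Coprime.pow_left a₀ ((Nat.Prime.coprime_iff_not_dvd hp.out).mpr he)
      have hdvd : p ^ a₀ ∣ e * a₀ := ⟨s.toNat, by rw [← heq']; ring⟩
      have hdvd' : p ^ a₀ ∣ a₀ := hcop.dvd_of_dvd_mul_left hdvd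
      have hle : p ^ a₀ ≤ a₀ := Nat.le_of_dvd (Nat.pos_of_ne_zero ha₀) hdvd'
      exact absurd hle (not_le.mpr (Nat.lt_pow_self hp.out.one_lt))
    -- the dominant index is `n₀ + 1 = p^{a₀}`
    obtain ⟨n₀, hn₀1⟩ : ∃ n₀ : ℕ, n₀ + 1 = p ^ a₀ :=
      ⟨p ^ a₀ - 1, Nat.sub_add_cancel (Nat.one_le_pow _ _ hp.out.pos)⟩
    have hN₀ : s * ((n₀ + 1 : ℕ) : ℤ) - (e : ℤ) * (padicValNat p (n₀ + 1) : ℤ)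
        = s * (p : ℤ) ^ a₀ - e * (a₀ : ℤ) := by
      rw [hn₀1, padicValNat.prime_pow]
      push_cast
      ring
    have hdom : ∀ n : ℕ, n ≠ n₀ → s * (p : ℤ) ^ a₀ - e * (a₀ : ℤ) + 1
        ≤ s * ((n + 1 : ℕ) : ℤ) - (e : ℤ) * (padicValNat p (n + 1) : ℤ) := by
      intro n hn
      obtain ⟨a, ha, ha'⟩ := exists_exponent_le_index (p := p) hs1 e (Nat.succ_ne_zero n)
      by_cases haa : a = a₀
      · have hne : n + 1 ≠ p ^ a := by
          rw [haa, ← hn₀1]; intro h; exact hn (by omega)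
        have := ha' hne
        rw [haa] at this
        exact this
      · exact (hstrict a haa).trans ha
    have hnorm := norm_logSeries_eq_zpow_of_dominant p hϖ hyP hs n₀ hN₀ hdom
    rw [hnorm]
    intro h1
    exact hne0 (zpow_right_injective₀ hρ0 hϖ.1.ne (h1.trans (zpow_zero _).symm))

/-- **`p ∤ e(K/ℚ_p)` ⇒ `‖log_p u‖ ≠ 1` for every `u : K`** (every prime `p`): for a unit,
`log_p u = m⁻¹·L(u^m)` with `u^m` principal and `p ∤ m` (`‖m⁻¹‖ = 1`); for a non-unit `log_p u = 0`.
In particular for `p = 2` and ODD `e` the `2`-adic logarithm of a unit is never a unit.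
[cite: NeukirchANT1999, Ch. II (5.5)] -/
theorem norm_unitLog_ne_one_of_not_dvd (he : ¬ p ∣ absRamificationIdx p K) (u : K) :
    ‖unitLog u‖ ≠ 1 := by
  by_cases hu : ‖u‖ = 1
  · obtain ⟨m, hm0, hmp, hmP⟩ := exists_pow_isPrincipal_not_dvd (p := p) hu
    rw [unitLog_eq_inv_mul_logSeries p hm0 hmP, norm_mul, norm_inv,
      norm_natCast_eq_one_of_not_dvd p hmp, inv_one, one_mul]
    exact norm_logSeries_ne_one_of_not_dvd p he hmP
  · rw [unitLog_of_norm_ne_one hu, norm_zero]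
    exact zero_ne_one

/-- **`p ∤ e` ⇒ `log_p(𝒪_K^×)` misses the unit sphere.** [cite: NeukirchANT1999, Ch. II (5.5)] -/
theorem logUnits_inter_sphere_eq_empty_of_not_dvd (he : ¬ p ∣ absRamificationIdx p K) :
    logUnits K ∩ sphere 0 1 = ∅ := by
  ext z
  simp only [mem_inter_iff, mem_sphere_zero_iff_norm, mem_empty_iff_false, iff_false, not_and]
  rintro ⟨u, -, rfl⟩
  exact norm_unitLog_ne_one_of_not_dvd p he u

/-- … so the "second iterate" of `log_p` on units has EMPTY domain when `p ∤ e`.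
[cite: NeukirchANT1999, Ch. II (5.5)] -/
theorem unitLog_image_logUnits_inter_sphere_eq_empty_of_not_dvd (he : ¬ p ∣ absRamificationIdx p K) :
    unitLog '' (logUnits K ∩ sphere 0 1) = ∅ := by
  rw [logUnits_inter_sphere_eq_empty_of_not_dvd p he, image_empty]

/-- `p ∤ e` ⇒ `log_p(𝒪_K^×) ⊆ K ∖ {‖z‖ = 1}`: every `z ∈ log_p(𝒪_K^×)` has `‖z‖ ≠ 1`.
[cite: NeukirchANT1999, Ch. II (5.5)] -/
theorem norm_ne_one_of_mem_logUnits_of_not_dvd (he : ¬ p ∣ absRamificationIdx p K) {z : K}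
    (hz : z ∈ logUnits K) : ‖z‖ ≠ 1 := by
  obtain ⟨u, -, rfl⟩ := hz
  exact norm_unitLog_ne_one_of_not_dvd p he u

/-- Contrapositive, for BY-NAME use at wild places: a unit logarithm which is a unit forces
`p ∣ e(K/ℚ_p)` (e.g. `πᵖ = p` as in `UnitLogWildPrime`). [cite: NeukirchANT1999, Ch. II (5.5)] -/
theorem dvd_absRamificationIdx_of_norm_unitLog_eq_one {u : K} (hu : ‖unitLog u‖ = 1) :
    p ∣ absRamificationIdx p K := by
  by_contra he
  exact norm_unitLog_ne_one_of_not_dvd p he u hu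

end NotDvd

/-! ### §5. `p` odd, `p ∣ e`: a unit with a unit logarithm -/

section Dvd

variable (p : ℕ) [hp : Fact p.Prime]
variable {K : Type*} [NontriviallyNormedField K] [instK : NormedAlgebra ℚ_[p] K] [IsUltrametricDist K]
  [ProperSpace K]

/-- **`p` odd, `e = p·k`, `‖1 − y‖ = ‖ϖ‖^k` ⇒ `‖L(y)‖ = 1`**: the term of index `p` has exponent
`h(1) = k·p − e = 0` and dominates strictly (`a₀ = 1`; `e = pk < k·p·(p−1)` as `p ≥ 3`; `h(0) = k ≥ 1`,
`h(a) ≥ 1` for `a ≥ 2`). [cite: NeukirchANT1999, Ch. II (5.5)] -/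
theorem norm_logSeries_eq_one_of_dvd (hp2 : p ≠ 2) {ϖ : Kˣ} (hϖ : IsUniformizer ϖ) {k : ℕ}
    (hk : absRamificationIdx p K = p * k) {y : K} (hy : ‖1 - y‖ = ‖(ϖ : K)‖ ^ (k : ℤ)) :
    ‖logSeries y‖ = 1 := by
  set e : ℕ := absRamificationIdx p K with he_def
  have he1 : 1 ≤ e := absRamificationIdx_pos p K
  have hk1 : 1 ≤ k := by
    rcases Nat.eq_zero_or_pos k with h0 | h0
    · rw [h0, mul_zero] at hk; omega
    · exact h0
  have hp3 : 3 ≤ p := by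
    have := hp.out.two_le
    omega
  have hyP : IsPrincipal y := by
    show ‖1 - y‖ < 1
    rw [hy]
    exact zpow_lt_one₀ (norm_units_pos ϖ) hϖ.1 (by exact_mod_cast hk1)
  have hS : (1 : ℤ) ≤ (k : ℤ) := by exact_mod_cast hk1
  have hP : (2 : ℤ) ≤ (p : ℤ) := by exact_mod_cast hp.out.two_le
  have hek : (e : ℤ) = (p : ℤ) * k := by rw [hk]; push_cast; ring
  -- turning point `a₀ = 1`, strict
  have hlo : ∀ a < 1, (k : ℤ) * (p : ℤ) ^ a * ((p : ℤ) - 1) < e := by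
    intro a ha
    have ha0 : a = 0 := by omega
    rw [ha0, pow_zero, mul_one, hek]
    nlinarith
  have hhi : (e : ℤ) < (k : ℤ) * (p : ℤ) ^ 1 * ((p : ℤ) - 1) := by
    rw [pow_one, hek]
    have hp3' : (3 : ℤ) ≤ (p : ℤ) := by exact_mod_cast hp3
    nlinarith
  have hstrict : ∀ a : ℕ, a ≠ 1 →
      (k : ℤ) * (p : ℤ) ^ 1 - e * ((1 : ℕ) : ℤ) + 1 ≤ (k : ℤ) * (p : ℤ) ^ a - e * (a : ℤ) :=
    fun a ha ↦ exponent_min_strict (a₀ := 1) hS hP hlo hhi ha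
  have h1 : (k : ℤ) * (p : ℤ) ^ 1 - e * ((1 : ℕ) : ℤ) = 0 := by rw [pow_one, hek]; push_cast; ring
  -- dominant index `n₀ + 1 = p`
  obtain ⟨n₀, hn₀1⟩ : ∃ n₀ : ℕ, n₀ + 1 = p := ⟨p - 1, Nat.sub_add_cancel hp.out.one_le⟩
  have hN₀ : (k : ℤ) * ((n₀ + 1 : ℕ) : ℤ) - (e : ℤ) * (padicValNat p (n₀ + 1) : ℤ) = 0 := by
    rw [hn₀1, padicValNat_self, hek]
    push_cast
    ring
  have hdom : ∀ n : ℕ, n ≠ n₀ →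
      (0 : ℤ) + 1 ≤ (k : ℤ) * ((n + 1 : ℕ) : ℤ) - (e : ℤ) * (padicValNat p (n + 1) : ℤ) := by
    intro n hn
    obtain ⟨a, ha, ha'⟩ := exists_exponent_le_index (p := p) hS e (Nat.succ_ne_zero n)
    by_cases haa : a = 1
    · have hne : n + 1 ≠ p ^ a := by
        rw [haa, pow_one, ← hn₀1]; intro h; exact hn (by omega)
      have := ha' hne
      rw [haa, h1] at this
      exact this
    · have h2 := hstrict a haa
      rw [h1] at h2
      exact h2.trans ha
  rw [norm_logSeries_eq_zpow_of_dominant p hϖ hyP hy n₀ hN₀ hdom, zpow_zero]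

/-- **`p` odd, `p ∣ e(K/ℚ_p)` (`e = p·k`) ⇒ the unit `1 − ϖ^k` has a unit logarithm**, for every norm
uniformizer `ϖ`. [cite: NeukirchANT1999, Ch. II (5.5)] -/
theorem norm_unitLog_eq_one_of_dvd (hp2 : p ≠ 2) {ϖ : Kˣ} (hϖ : IsUniformizer ϖ) {k : ℕ}
    (hk : absRamificationIdx p K = p * k) :
    ‖(1 : K) - (ϖ : K) ^ k‖ = 1 ∧ ‖unitLog ((1 : K) - (ϖ : K) ^ k)‖ = 1 := by
  have hy : ‖1 - ((1 : K) - (ϖ : K) ^ k)‖ = ‖(ϖ : K)‖ ^ (k : ℤ) := by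
    rw [sub_sub_cancel, norm_pow, zpow_natCast]
  have hk1 : 1 ≤ k := by
    rcases Nat.eq_zero_or_pos k with h0 | h0
    · have := absRamificationIdx_pos p K
      rw [hk, h0, mul_zero] at this
      omega
    · exact h0
  have hyP : IsPrincipal ((1 : K) - (ϖ : K) ^ k) := by
    show ‖1 - ((1 : K) - (ϖ : K) ^ k)‖ < 1
    rw [hy]
    exact zpow_lt_one₀ (norm_units_pos ϖ) hϖ.1 (by exact_mod_cast hk1)
  refine ⟨hyP.norm_eq_one, ?_⟩
  rw [unitLog_of_isPrincipal p hyP]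
  exact norm_logSeries_eq_one_of_dvd p hp2 hϖ hk hy

/-- **`p` odd, `p ∣ e` ⇒ some unit of `𝒪_K` has a unit logarithm.** [cite: NeukirchANT1999, Ch. II (5.5)] -/
theorem exists_norm_unitLog_eq_one_of_dvd (hp2 : p ≠ 2) (he : p ∣ absRamificationIdx p K) :
    ∃ u : K, ‖u‖ = 1 ∧ ‖unitLog u‖ = 1 := by
  obtain ⟨k, hk⟩ := he
  obtain ⟨ϖ, hϖ⟩ := exists_isUniformizer (F := K)
  exact ⟨_, norm_unitLog_eq_one_of_dvd p hp2 hϖ hk⟩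

/-- **`p` odd, `p ∣ e` ⇒ `log_p(𝒪_K^×)` meets the unit sphere.** [cite: NeukirchANT1999, Ch. II (5.5)] -/
theorem logUnits_inter_sphere_nonempty_of_dvd (hp2 : p ≠ 2) (he : p ∣ absRamificationIdx p K) :
    (logUnits K ∩ sphere 0 1).Nonempty := by
  obtain ⟨u, hu, hlog⟩ := exists_norm_unitLog_eq_one_of_dvd p hp2 he
  exact ⟨unitLog u, unitLog_mem_logUnits hu, mem_sphere_zero_iff_norm.mpr hlog⟩

/-- **`p` odd, `p ∣ e` ⇒ `log_p(𝒪_K^×) ⊄ 𝔪_K`.** [cite: NeukirchANT1999, Ch. II (5.5)] -/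
theorem not_logUnits_subset_ball_of_dvd (hp2 : p ≠ 2) (he : p ∣ absRamificationIdx p K) :
    ¬ logUnits K ⊆ ball 0 1 := by
  obtain ⟨z, hz, hz1⟩ := logUnits_inter_sphere_nonempty_of_dvd p hp2 he
  intro h
  have := h hz
  rw [mem_ball_zero_iff, mem_sphere_zero_iff_norm.mp hz1] at this
  exact lt_irrefl _ this

/-- … and the "second iterate" of `log_p` on units has INHABITED domain.
[cite: NeukirchANT1999, Ch. II (5.5)] -/
theorem unitLog_image_logUnits_inter_sphere_nonempty_of_dvd (hp2 : p ≠ 2)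
    (he : p ∣ absRamificationIdx p K) : (unitLog '' (logUnits K ∩ sphere 0 1)).Nonempty :=
  (logUnits_inter_sphere_nonempty_of_dvd p hp2 he).image _

/-! ### §6. The criterion at odd `p` -/

/-- **THE RAMIFICATION CRITERION (odd `p`)**: the `p`-adic logarithm of SOME unit of `K` is a unit — i.e.
`log_p(𝒪_K^×)` meets `𝒪_K^×` — if and only if `p` divides the absolute ramification index `e(K/ℚ_p)`.
[cite: NeukirchANT1999, Ch. II (5.5)] -/
theorem logUnits_inter_sphere_nonempty_iff_dvd (hp2 : p ≠ 2) :
    (logUnits K ∩ sphere 0 1).Nonempty ↔ p ∣ absRamificationIdx p K := by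
  refine ⟨fun h ↦ ?_, logUnits_inter_sphere_nonempty_of_dvd p hp2⟩
  by_contra he
  rw [logUnits_inter_sphere_eq_empty_of_not_dvd p he] at h
  exact Set.not_nonempty_empty h

/-- Equivalently: `(∃ u, ‖u‖ = 1 ∧ ‖log_p u‖ = 1) ⟺ p ∣ e(K/ℚ_p)` (`p` odd).
[cite: NeukirchANT1999, Ch. II (5.5)] -/
theorem exists_norm_unitLog_eq_one_iff_dvd (hp2 : p ≠ 2) :
    (∃ u : K, ‖u‖ = 1 ∧ ‖unitLog u‖ = 1) ↔ p ∣ absRamificationIdx p K :=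
  ⟨fun ⟨_, _, hu⟩ ↦ dvd_absRamificationIdx_of_norm_unitLog_eq_one p hu,
    exists_norm_unitLog_eq_one_of_dvd p hp2⟩

/-- Equivalently, on the negative side: `log_p(𝒪_K^×)` misses the unit sphere `⟺ p ∤ e(K/ℚ_p)`
(`p` odd). [cite: NeukirchANT1999, Ch. II (5.5)] -/
theorem logUnits_inter_sphere_eq_empty_iff_not_dvd (hp2 : p ≠ 2) :
    logUnits K ∩ sphere 0 1 = ∅ ↔ ¬ p ∣ absRamificationIdx p K := by
  rw [← Set.not_nonempty_iff_eq_empty, logUnits_inter_sphere_nonempty_iff_dvd p hp2]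

/-- … and `log_p(𝒪_K^×) ⊆ 𝔪_K ∪ (K ∖ 𝒪_K)` fails to be inside `𝔪_K`-or-outside exactly when `p ∣ e`:
`¬ (log_p(𝒪_K^×) ⊆ ball 0 1) ⟸ p ∣ e`, while `p ∤ e ⇒ ∀ z ∈ log_p(𝒪_K^×), ‖z‖ ≠ 1`
(`norm_ne_one_of_mem_logUnits_of_not_dvd`). For `e ≤ p − 1` the sharper `⊆ 𝔪_K` is
`logUnits_subset_ball_of_absRamificationIdx_le`. [cite: NeukirchANT1999, Ch. II (5.5)] -/
theorem unitLog_image_logUnits_inter_sphere_nonempty_iff_dvd (hp2 : p ≠ 2) :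
    (unitLog '' (logUnits K ∩ sphere 0 1)).Nonempty ↔ p ∣ absRamificationIdx p K := by
  rw [Set.image_nonempty, logUnits_inter_sphere_nonempty_iff_dvd p hp2]

end Dvd

end RamificationCriterion

end Literature.IUT.LogVolume

end
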